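import Summits.KontsevichZagierPeriods.Zeta5Search.XSaveConjectures
import Summits.KontsevichZagierPeriods.Zeta5Search.SymRayZudilin15
import Summits.KontsevichZagierPeriods.Zeta5Search.SymRayWedgeDictionary
import HarnessLib

/-!
# XSAVE: the two symmetric corners are theorems (cell `pub-zeta5`, TYPER g6 for census g7)

HONEST FRAMING: systematic search; no irrationality claim unless certified.

`XSaveConjectures.lean` (census g7 v3, filed by typer) records two "decidable instances" at the totally symmetric
direction that motivated the hypotheses `p ≠ 2` / `3 < p` of the D-laws: `cornerTwo` (`v₂(P(1⁸)) = v₂(P̂(1⁸)) = −2`,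
partner `j = 1`) and `cornerThree` (`v₃(P(2⁸)) = −1`), tagged `@[conjecture]` there "because a kernel proof needs an
evaluator for `coeffV`".  No evaluator is needed: on the symmetric ray P1's `SymRay.bz_P_ray` / `bz_Phat_ray`
(Zudilin (15), all `n`) identify the dictionary numerators `POf (n·1⁸) 1`, `PhatOf (n·1⁸) 1` with Brown–Zudilin's
PRINTED `P_n`, `P̂_n` (`TotallySymmetric.P 1 = 87/4`, `Phat 1 = 101/4`, `P 2 = 1190161/384`), whose valuations are
arithmetic.  This file proves `POf_diag`/`PhatOf_diag` and **`cornerTwo_holds`, `cornerThree_holds`**.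
-/

noncomputable section

open Finset

namespace Summit.KontsevichZagierPeriods.Zeta5Search.XSave

open Summit.KontsevichZagierPeriods.Zeta5Search.WedgeDictionary (rhoOf coeffU coeffW coeffV)
open Summit.KontsevichZagierPeriods.Zeta5Search.SymRay (aDiag bRay bRay' bOfA_diag rhoOf_diag bz_P_ray bz_Phat_ray)
open Literature.NumberTheory.Irrationality.BrownZudilin2022 (bOfA P Phat)

/-- On the diagonal `a = n·1⁸` with partner `j = 1`, the dictionary `ζ(5)`-numerator IS Brown–Zudilin's `P_n`. -/
theorem POf_diag (n : ℕ) : POf (aDiag n) 1 = P n := by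
  unfold POf
  simp only [bOfA_diag]
  rw [bz_P_ray n, rhoOf_diag n, show Function.update (bRay n) 1 (bRay n 1 + 1) = bRay' n from rfl]
  ring

/-- On the diagonal with partner `j = 1`, the dictionary `ζ(3)`-numerator IS Brown–Zudilin's `P̂_n`. -/
theorem PhatOf_diag (n : ℕ) : PhatOf (aDiag n) 1 = Phat n := by
  unfold PhatOf
  simp only [bOfA_diag]
  rw [bz_Phat_ray n, rhoOf_diag n, show Function.update (bRay n) 1 (bRay n 1 + 1) = bRay' n from rfl]

/-- `![1,…,1] = aDiag 1` and `![2,…,2] = aDiag 2`. -/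
theorem vec_ones_eq_aDiag : (![1, 1, 1, 1, 1, 1, 1, 1] : Fin 8 → ℤ) = aDiag 1 ∧
    (![2, 2, 2, 2, 2, 2, 2, 2] : Fin 8 → ℤ) = aDiag 2 := by
  constructor <;> (funext i; fin_cases i <;> rfl)

/-- `v₂(87/4) = −2`, `v₂(101/4) = −2`, `v₃(1190161/384) = −1`. -/
theorem corner_valuations :
    padicValRat 2 (87 / 4 : ℚ) = -2 ∧ padicValRat 2 (101 / 4 : ℚ) = -2 ∧ padicValRat 3 (1190161 / 384 : ℚ) = -1 := by
  have h2 : Fact (Nat.Prime 2) := ⟨Nat.prime_two⟩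
  have h3 : Fact (Nat.Prime 3) := ⟨Nat.prime_three⟩
  refine ⟨?_, ?_, ?_⟩
  · rw [show (87 / 4 : ℚ) = ((87 : ℕ) : ℚ) / ((4 : ℕ) : ℚ) by norm_num,
      padicValRat.div (by norm_num) (by norm_num), padicValRat.of_nat, padicValRat.of_nat,
      show (4 : ℕ) = 2 ^ 2 by norm_num, padicValNat.prime_pow,
      padicValNat.eq_zero_of_not_dvd (by norm_num)]
    norm_num
  · rw [show (101 / 4 : ℚ) = ((101 : ℕ) : ℚ) / ((4 : ℕ) : ℚ) by norm_num,
      padicValRat.div (by norm_num) (by norm_num), padicValRat.of_nat, padicValRat.of_nat,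
      show (4 : ℕ) = 2 ^ 2 by norm_num, padicValNat.prime_pow,
      padicValNat.eq_zero_of_not_dvd (by norm_num)]
    norm_num
  · rw [show (1190161 / 384 : ℚ) = ((1190161 : ℕ) : ℚ) / ((384 : ℕ) : ℚ) by norm_num,
      padicValRat.div (by norm_num) (by norm_num), padicValRat.of_nat, padicValRat.of_nat,
      show (384 : ℕ) = 3 * 128 by norm_num, padicValNat.mul (by norm_num) (by norm_num), padicValNat.self (by norm_num),
      padicValNat.eq_zero_of_not_dvd (show ¬ 3 ∣ 128 by norm_num),
      padicValNat.eq_zero_of_not_dvd (show ¬ 3 ∣ 1190161 by norm_num)]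
    norm_num

/-- **`cornerTwo` is a theorem**: `v₂(P(1⁸)) = v₂(P̂(1⁸)) = −2` (partner `j = 1`; `P₁ = 87/4`, `P̂₁ = 101/4`). -/
theorem cornerTwo_holds : cornerTwo := by
  unfold cornerTwo
  rw [vec_ones_eq_aDiag.1, POf_diag, PhatOf_diag]
  simp only [P, Phat, Literature.NumberTheory.Irrationality.BrownZudilin2022.recSol_one]
  exact ⟨corner_valuations.1, corner_valuations.2.1⟩

/-- **`cornerThree` is a theorem**: `v₃(P(2⁸)) = −1` (`P₂ = 1190161/384 = 1190161/(2⁷·3)`). -/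
theorem cornerThree_holds : cornerThree := by
  unfold cornerThree
  rw [vec_ones_eq_aDiag.2, POf_diag]
  simp only [P, Literature.NumberTheory.Irrationality.BrownZudilin2022.recSol_two]
  exact corner_valuations.2.2

end Summit.KontsevichZagierPeriods.Zeta5Search.XSave
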